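import Literature.AlgebraicGeometry.HodgeTheory.LefschetzOperatorsKunneth
import Literature.AlgebraicGeometry.HodgeTheory.DiagonalClassOfProduct
import HarnessLib

/-!
# André 1996 §1.3 on the carriers: `P•(Y) ⊗ P•(Z) ⊆ P•(Y × Z)` — primitive classes of the factors cross to primitive
# classes of the product class `pr_Y^* η + pr_Z^* η'`, the binomial formula for `L_θ^c (x × y)`, and the top of the
# product string `L_θ^{a+b} (p × q) = C(a+b, a) · Lᵃ p × L'ᵇ q`

Family `hodge`, lane `lit-hodgefound` (Track 2 foundations library), layer `Literature/AlgebraicGeometry/HodgeTheory`,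
namespace `Literature.AlgebraicGeometry.HodgeTheory`; prover seat `lit-hodgefound-p21` (generation 37, row g37-#2), sequel
of `HodgeTheory/LefschetzOperatorsKunneth` (g36-#2: the Künneth isomorphism `κ` intertwines `h`, `L`, `ᶜΛ`, `*_L`, `w`,
`*_H`; Lemme 1.3.1 on the top of a product string through `*_L`) closing successor note (b) of generation 36: the
INCLUSION `P•(Y) ⊗ P•(Z) ⊆ P•(Y × Z)` itself, on elements of `H*((Y × Z)(ℂ); ℂ)` and in homogeneous form on
`H^{i+j}((Y × Z)(ℂ); ℂ)`.  THEOREMS ONLY (no definition, no named fact, no instance; D-0026 net debt `0`).  The ABSTRACT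
statements are the tree's (p34 g31-#2 `Algebra/Lie/LefschetzModuleWeylOperatorTensor`: `tmul_mem_primitiveSpace`,
`pow_rTensor_add_lTensor_apply_tmul_primitive`; `Algebra/Lie/LefschetzModuleTensorFactor`:
`rTensor_add_lTensor_pow_tmul`; `Algebra/Lie/LefschetzModuleTransport`: `apply_mem_primitiveSpace_of_semiconj`); this
file transports them along `κ = kunnethEquiv` and reads them on the summands.

## Source, VERBATIM (Y. André, *Pour une théorie inconditionnelle des motifs*, Publ. Math. IHÉS 83 (1996), §1.3 p. 12
= held `paper:doi-10-1007-bf02698643` p0009 L34–L42, re-read this session; Lemme 1.3.1 p. 13 = p0010)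

«1.3. […] L'isomorphisme (d'algèbres graduées) de Künneth : `H•(X × Y) ≅ H•(X) ⊗ H•(Y)` devient un isomorphisme de
`𝔰𝔩₂`-modules si l'on munit `X × Y` du faisceau inversible ample `𝓛_{X×Y} = p_X^* 𝓛_X ⊗ p_Y^* 𝓛_Y`.  Par le formalisme
des `𝔰𝔩₂`-triplets (cf. [D80] 1.6.12.1, avec le dictionnaire `N = ᶜΛ`, `Gr_i = H^{d-i}(X)`, `P_{-i} = P^{d-i}(X)`), on
déduit de l'isomorphisme de `𝔰𝔩₂`-représentations `Sⁱ ⊗ Sʲ ≅ ⊕_{k} S^{i+j-2k}` (Clebsch–Gordan) un isomorphisme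
canonique : `P•(X × Y) ≅ ⊕ … P•(X) ⊗ P•(Y)`; l'inclusion `P•(X) ⊗ P•(Y) ⊆ P•(X × Y)` fournie par cet isomorphisme est
restriction de l'isomorphisme de Künneth.»  Lemme 1.3.1 (p. 13) considers `Pⁱ(X) ⊗ Pʲ(Y)` «comme un sous-espace de
`P^{i+j}(X × Y)` et `L^{d-i}Pⁱ(X) ⊗ L^{d'-j}Pʲ(Y)` comme un sous-espace de `L^{d-i+d'-j}P^{i+j}(X × Y)`» — its proof
rests on `L_{X×Y}^{d+d'-i-j} = c · L_X^{d-i} ⊗ L_Y^{d'-j}` on `Pⁱ(X) ⊗ Pʲ(Y)`, `c = C(d+d'-i-j, d-i)`.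
E. Looijenga, V. A. Lunts, Invent. Math. 129 (1997), §1 (1.1) p. 4: «`e(m' ⊗ m'') = e m' ⊗ m'' + m' ⊗ e m''`» on
`M' ⊠ M''`.  A. Hatcher, *Algebraic Topology* (2002), §3.2 Thm. 3.16 (Künneth: `a × b = p₁^* a ⌣ p₂^* b`).

## Rendering (the tree's carriers, as in `LefschetzOperatorsKunneth`)

`M_Y = totalCohomology ℂ Y(ℂ)`, `h_Y = degreeOperator ℂ Y(ℂ) m`, `L_η = totalLefschetz η`; the abstract primitive part
`P_{-a}(M_Y) = primitiveSpace h_Y L_η a` meets `Hⁱ` in `Pⁱ(Y) = lefschetzPrimitive η (i + (a+1) = m+1)` when `i + a = m`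
(`ofDegree_mem_primitiveSpace_iff`).  On `Y × Z` (`Y ⊗ Z` in `SchemeOver ℂ`): `θ = pr_Y^* η + pr_Z^* η'`, `× =
kunnethCross Y Z` (`a ⊗ b ↦ pr_Y^* a ⌣ pr_Z^* b`), `κ = kunnethEquiv hY hZ` for `Y`, `Z` smooth projective.

## WHAT IS PROVED (`Y`, `Z` smooth projective over `ℂ` of dimensions `m`, `n` where stated; `η ∈ H²(Y(ℂ))`, `η' ∈ H²(Z(ℂ))`)

* §1 `pow_totalLefschetz_map_fst_add_map_snd_kunnethCross` (`L_θ^c ∘ × = × ∘ (L_η ⊗ 1 + 1 ⊗ L_η')^c`, any spaces),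
  **`pow_totalLefschetz_kunnethCross_tmul_ofDegree`** (the binomial formula
  `L_θ^c (x × y) = Σ_{k ≤ c} C(c, k) · Lᵏ x × L'^{c-k} y` for homogeneous `x ∈ Hⁱ(Y)`, `y ∈ Hʲ(Z)`).
* §2 **`kunnethCross_tmul_mem_primitiveSpace`** (`P_{-a}(M_Y) ⊗ P_{-b}(M_Z) → P_{-(a+b)}(M_{Y×Z})` under `×`),
  **`cupProduct_map_fst_map_snd_mem_lefschetzPrimitive`** («`Pⁱ(X) ⊗ Pʲ(Y) ⊆ P^{i+j}(X × Y)`»: for `p ∈ Pⁱ(Y)`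
  (`i + a = m`), `q ∈ Pʲ(Z)` (`j + b = n`), `pr_Y^* p ⌣ pr_Z^* q ∈ P^{i+j}(Y × Z)`, i.e. `L_θ^{a+b+1}` kills it),
  `one_mem_lefschetzPrimitive` (`1 ∈ P⁰(Z)`), **`map_fst_mem_lefschetzPrimitive`**, **`map_snd_mem_lefschetzPrimitive`**
  (`pr_Y^* p ∈ Pⁱ(Y × Z)` with index `a + n`: the case `q = 1`).
* §3 **`lefschetzPow_cupProduct_map_fst_map_snd_top`** (Lemme 1.3.1, proof: `L_θ^{a+b}(pr_Y^* p ⌣ pr_Z^* q) =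
  C(a+b, a) · (pr_Y^* Lᵃ p ⌣ pr_Z^* L'ᵇ q)` in `H^{i+j+2(a+b)}((Y × Z)(ℂ))`), `kunnethCross_tmul_ofDegree_ne_zero` (`x × y ≠ 0` in `H*` for
  homogeneous `x, y ≠ 0`: Künneth is injective; the homogeneous form is the tree's
  `cupProduct_map_fst_map_snd_ne_zero_of_ne_zero` of `DiagonalClassOfProduct`, reused),
  **`lefschetzPow_cupProduct_map_fst_map_snd_top_ne_zero`** (under hard Lefschetz of `η`, `η'`: for non-zero primitive
  `p`, `q` the top `L_θ^{a+b}(p × q)` is non-zero — the string through `p × q` has the exact length `a + b + 1`, i.e.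
  `p × q` spans a copy of `S^{a+b}` inside `Sᵃ ⊗ Sᵇ`, the top summand of Clebsch–Gordan).

## SCOPE / NOT HERE

The canonical isomorphism `P•(X × Y) ≅ ⊕ P•(X) ⊗ P•(Y)` (all Clebsch–Gordan summands, not only the top one) and its
dimension count are not formalized; [D80] 1.6.12.1 is not used.

## References

* [Andre1996Motifs] Y. André, Publ. Math. IHÉS 83 (1996), §1.1 (p. 10), §1.3 (p. 12) and Lemme 1.3.1 (p. 13).
* [LooijengaLunts1997] E. Looijenga, V. A. Lunts, Invent. Math. 129 (1997), §1 (1.1) p. 4.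
* [HatcherAT2002] A. Hatcher, *Algebraic Topology* (2002), §3.2 Thm. 3.16, Prop. 3.10.
* [VoisinHodgeI2002] C. Voisin, *Hodge Theory and Complex Algebraic Geometry I* (2002), Def. 6.24, Thm. 6.25.
-/

noncomputable section

open CategoryTheory MonoidalCategory CartesianMonoidalCategory
open scoped TensorProduct
open Literature.AlgebraicTopology.SingularHomology
open Literature.AlgebraicGeometry.Motives
open Literature.AlgebraicGeometry.Hyperkaehler
open Literature.Geometry.Kaehler
open Literature.Algebra.Lie
open Literature.Algebra.Lie.HasLefschetzProperty (primitiveSpace mem_primitiveSpace_iff)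

namespace Literature.AlgebraicGeometry.HodgeTheory

variable {m n : ℕ} {Y Z : SchemeOver ℂ}

/-! ### §1 `L_θ^c` through the cross map: the binomial formula -/

section Binomial

variable (η : complexBetti Y 2) (η' : complexBetti Z 2)

/-- **`L_θ^c ∘ × = × ∘ (L_η ⊗ 1 + 1 ⊗ L_η')^c`** for `θ = pr_Y^* η + pr_Z^* η'` (iterate of Looijenga–Lunts'
`e(m' ⊗ m'') = e m' ⊗ m'' + m' ⊗ e m''`, the tree's `totalLefschetz_totalCross`).
[cite: LooijengaLunts1997, §1 (1.1) p. 4] [cite: Andre1996Motifs, §1.3 (p. 12)] -/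
theorem pow_totalLefschetz_map_fst_add_map_snd_kunnethCross (c : ℕ)
    (v : totalCohomology ℂ (ComplexPoints Y) ⊗[ℂ] totalCohomology ℂ (ComplexPoints Z)) :
    (totalLefschetz (complexBetti.map (fst Y Z) 2 η + complexBetti.map (snd Y Z) 2 η') ^ c) (kunnethCross Y Z v) =
      kunnethCross Y Z ((((totalLefschetz η).rTensor (totalCohomology ℂ (ComplexPoints Z)) +
        (totalLefschetz η').lTensor (totalCohomology ℂ (ComplexPoints Y))) ^ c) v) := by
  induction c generalizing v with
  | zero => simp only [pow_zero, Module.End.one_apply]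
  | succ c ih =>
    rw [pow_succ, Module.End.mul_apply, totalLefschetz_totalCross, ih, ← Module.End.mul_apply, ← pow_succ]

/-- **The binomial formula `L_θ^c (x × y) = Σ_{k ≤ c} C(c, k) · Lᵏ x × L'^{c-k} y`** for homogeneous `x ∈ Hⁱ(Y(ℂ))`,
`y ∈ Hʲ(Z(ℂ))`, in `H*((Y × Z)(ℂ); ℂ)` (`L_η ⊗ 1` and `1 ⊗ L_η'` commute; `(κ ⌣ ·)ᵏ` on `Hⁱ` is the tree's
`lefschetzPow`). [cite: LooijengaLunts1997, §1 (1.1) p. 4] [cite: Andre1996Motifs, §1.3 Lemme 1.3.1 (p. 13, proof)] -/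
theorem pow_totalLefschetz_kunnethCross_tmul_ofDegree (c : ℕ) {i j : ℕ} (x : complexBetti Y i) (y : complexBetti Z j) :
    (totalLefschetz (complexBetti.map (fst Y Z) 2 η + complexBetti.map (snd Y Z) 2 η') ^ c)
        (kunnethCross Y Z (ofDegree ℂ (ComplexPoints Y) i x ⊗ₜ ofDegree ℂ (ComplexPoints Z) j y)) =
      ∑ k ∈ Finset.range (c + 1), (c.choose k : ℂ) •
        kunnethCross Y Z (ofDegree ℂ (ComplexPoints Y) (i + 2 * k) (lefschetzPow η k i x) ⊗ₜ
          ofDegree ℂ (ComplexPoints Z) (j + 2 * (c - k)) (lefschetzPow η' (c - k) j y)) := by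
  rw [pow_totalLefschetz_map_fst_add_map_snd_kunnethCross, rTensor_add_lTensor_pow_tmul, map_sum]
  refine Finset.sum_congr rfl fun k _ ↦ ?_
  rw [map_smul, pow_totalLefschetz_ofDegree, pow_totalLefschetz_ofDegree]

end Binomial

/-! ### §2 `P•(Y) ⊗ P•(Z) ⊆ P•(Y × Z)` -/

section Primitive

/-- **`P_{-a}(M_Y) ⊗ P_{-b}(M_Z) ↦ P_{-(a+b)}(M_{Y×Z})` under the cross map**: for `p ∈ H*(Y(ℂ))` primitive of
weight `-a` (for `h_Y`, `L_η`) and `q ∈ H*(Z(ℂ))` primitive of weight `-b`, the class `p × q` is primitive of weight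
`-(a+b)` for `h_{Y×Z}`, `L_θ` — the abstract `tmul_mem_primitiveSpace` transported along the Künneth isomorphism
(«l'inclusion `P•(X) ⊗ P•(Y) ⊆ P•(X × Y)` fournie par cet isomorphisme est restriction de l'isomorphisme de Künneth»).
[cite: Andre1996Motifs, §1.3 (p. 12)] [cite: LooijengaLunts1997, §1 (1.1) p. 4] -/
theorem kunnethCross_tmul_mem_primitiveSpace (hY : IsSmoothProjective m Y) (hZ : IsSmoothProjective n Z)
    {η : complexBetti Y 2} {η' : complexBetti Z 2} {a b : ℕ} {p : totalCohomology ℂ (ComplexPoints Y)}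
    {q : totalCohomology ℂ (ComplexPoints Z)}
    (hp : p ∈ primitiveSpace (degreeOperator ℂ (ComplexPoints Y) m) (totalLefschetz η) a)
    (hq : q ∈ primitiveSpace (degreeOperator ℂ (ComplexPoints Z) n) (totalLefschetz η') b) :
    kunnethCross Y Z (p ⊗ₜ q) ∈
      primitiveSpace (degreeOperator ℂ (ComplexPoints (Y ⊗ Z)) (m + n))
        (totalLefschetz (complexBetti.map (fst Y Z) 2 η + complexBetti.map (snd Y Z) 2 η')) (a + b) := by
  rw [← kunnethEquiv_apply hY hZ]
  exact apply_mem_primitiveSpace_of_semiconj (Φ := (kunnethEquiv hY hZ).toLinearMap)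
    (fun x ↦ kunnethEquiv_degreeOperator_tensor hY hZ x) (fun x ↦ kunnethEquiv_totalLefschetz_tensor hY hZ η η' x)
    (tmul_mem_primitiveSpace hp hq)

/-- **«`Pⁱ(X) ⊗ Pʲ(Y) ⊆ P^{i+j}(X × Y)`» on the carriers**: for `p ∈ Pⁱ(Y) = ker L_η^{a+1}` (`i + a = m`) and
`q ∈ Pʲ(Z) = ker L_{η'}^{b+1}` (`j + b = n`), the cross product `pr_Y^* p ⌣ pr_Z^* q ∈ H^{i+j}((Y × Z)(ℂ); ℂ)` lies in
`P^{i+j}(Y × Z) = ker L_θ^{a+b+1}` for `θ = pr_Y^* η + pr_Z^* η'` (dictionary `P_{-a} = P^{m-a}`,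
`ofDegree_mem_primitiveSpace_iff`). [cite: Andre1996Motifs, §1.3 (p. 12) and Lemme 1.3.1 (p. 13)]
[cite: VoisinHodgeI2002, Def. 6.24] -/
theorem cupProduct_map_fst_map_snd_mem_lefschetzPrimitive (hY : IsSmoothProjective m Y) (hZ : IsSmoothProjective n Z)
    {η : complexBetti Y 2} {η' : complexBetti Z 2} {i a j b : ℕ} (hia : i + a = m) (hjb : j + b = n)
    {p : complexBetti Y i} (hp : p ∈ lefschetzPrimitive η (show i + (a + 1) = m + 1 by omega))
    {q : complexBetti Z j} (hq : q ∈ lefschetzPrimitive η' (show j + (b + 1) = n + 1 by omega)) :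
    cupProduct rfl (complexBetti.map (fst Y Z) i p) (complexBetti.map (snd Y Z) j q) ∈
      lefschetzPrimitive (complexBetti.map (fst Y Z) 2 η + complexBetti.map (snd Y Z) 2 η')
        (show i + j + (a + b + 1) = m + n + 1 by omega) := by
  have h := kunnethCross_tmul_mem_primitiveSpace hY hZ ((ofDegree_mem_primitiveSpace_iff hia η p).2 hp)
    ((ofDegree_mem_primitiveSpace_iff hjb η' q).2 hq)
  rw [totalCross_tmul_ofDegree] at h
  exact (ofDegree_mem_primitiveSpace_iff (show i + j + (a + b) = m + n by omega) _ _).1 h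

/-- **`1 ∈ P⁰(Z)`**: the unit class is primitive in top index, `L_{η'}^{n+1} 1 ∈ H^{2n+2}(Z(ℂ)) = 0` for `Z` smooth
projective of dimension `n`. [cite: VoisinHodgeI2002, Def. 6.24] [cite: HatcherAT2002, §3.3 Thm. 3.26(c)] -/
theorem one_mem_lefschetzPrimitive (hZ : IsSmoothProjective n Z) (η' : complexBetti Z 2) :
    singularCohomology.one ℂ (ComplexPoints Z) ∈ lefschetzPrimitive η' (show 0 + (n + 1) = n + 1 by omega) := by
  rw [mem_lefschetzPrimitive]
  exact complexBetti_eq_zero_of_lt hZ (0 + 2 * (n + 1)) (by omega) _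

/-- **Pull-backs of primitive classes along `pr_Y` are primitive for the product class**: for `p ∈ Pⁱ(Y)`
(`i + a = m`), `pr_Y^* p ∈ Pⁱ(Y × Z) = ker L_θ^{a+n+1}` — the case `q = 1 ∈ P⁰(Z)` of the inclusion
`Pⁱ(Y) ⊗ P⁰(Z) ⊆ Pⁱ(Y × Z)` (`p × 1 = pr_Y^* p`). [cite: Andre1996Motifs, §1.3 (p. 12)] [cite: HatcherAT2002, §3.2 Thm. 3.16] -/
theorem map_fst_mem_lefschetzPrimitive (hY : IsSmoothProjective m Y) (hZ : IsSmoothProjective n Z)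
    {η : complexBetti Y 2} (η' : complexBetti Z 2) {i a : ℕ} (hia : i + a = m) {p : complexBetti Y i}
    (hp : p ∈ lefschetzPrimitive η (show i + (a + 1) = m + 1 by omega)) :
    complexBetti.map (fst Y Z) i p ∈
      lefschetzPrimitive (complexBetti.map (fst Y Z) 2 η + complexBetti.map (snd Y Z) 2 η')
        (show i + (a + n + 1) = m + n + 1 by omega) := by
  have h := kunnethCross_tmul_mem_primitiveSpace hY hZ ((ofDegree_mem_primitiveSpace_iff hia η p).2 hp)
    ((ofDegree_mem_primitiveSpace_iff (show 0 + n = n by omega) η' _).2 (one_mem_lefschetzPrimitive hZ η'))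
  rw [totalCross_tmul_one, totalPullback_lof] at h
  exact (ofDegree_mem_primitiveSpace_iff (show i + (a + n) = m + n by omega) _ _).1 h

/-- **Pull-backs of primitive classes along `pr_Z` are primitive for the product class**: for `q ∈ Pʲ(Z)`
(`j + b = n`), `pr_Z^* q ∈ Pʲ(Y × Z) = ker L_θ^{m+b+1}` (`1 × q = pr_Z^* q`). [cite: Andre1996Motifs, §1.3 (p. 12)]
[cite: HatcherAT2002, §3.2 Thm. 3.16] -/
theorem map_snd_mem_lefschetzPrimitive (hY : IsSmoothProjective m Y) (hZ : IsSmoothProjective n Z)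
    (η : complexBetti Y 2) {η' : complexBetti Z 2} {j b : ℕ} (hjb : j + b = n) {q : complexBetti Z j}
    (hq : q ∈ lefschetzPrimitive η' (show j + (b + 1) = n + 1 by omega)) :
    complexBetti.map (snd Y Z) j q ∈
      lefschetzPrimitive (complexBetti.map (fst Y Z) 2 η + complexBetti.map (snd Y Z) 2 η')
        (show j + (m + b + 1) = m + n + 1 by omega) := by
  have h := kunnethCross_tmul_mem_primitiveSpace hY hZ
    ((ofDegree_mem_primitiveSpace_iff (show 0 + m = m by omega) η _).2 (one_mem_lefschetzPrimitive hY η))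
    ((ofDegree_mem_primitiveSpace_iff hjb η' q).2 hq)
  rw [totalCross_one_tmul, totalPullback_lof] at h
  exact (ofDegree_mem_primitiveSpace_iff (show j + (m + b) = m + n by omega) _ _).1 h

end Primitive

/-! ### §3 The top of the product string and non-vanishing -/

section Top

/-- **`L_θ^{a+b} (p × q) = C(a+b, a) · (Lᵃ p × L'ᵇ q)` in `H*`** for `p ∈ Pⁱ(Y)` (`i + a = m`), `q ∈ Pʲ(Z)`
(`j + b = n`): in the binomial expansion every other term has `Lᵏ p = 0` (`k > a`) or `L'^{a+b-k} q = 0` (`k < a`)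
(André: «`L_{X×Y}^{d+d'-i-j}` coïncide avec `c · L_X^{d-i} ⊗ L_Y^{d'-j}` sur `Pⁱ(X) ⊗ Pʲ(Y)`»; the abstract
`pow_rTensor_add_lTensor_apply_tmul_primitive`). [cite: Andre1996Motifs, §1.3 Lemme 1.3.1 (p. 13, proof)] -/
theorem pow_totalLefschetz_kunnethCross_tmul_ofDegree_top {η : complexBetti Y 2} {η' : complexBetti Z 2} {i a j b : ℕ}
    (hia : i + a = m) (hjb : j + b = n)
    {p : complexBetti Y i} (hp : p ∈ lefschetzPrimitive η (show i + (a + 1) = m + 1 by omega))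
    {q : complexBetti Z j} (hq : q ∈ lefschetzPrimitive η' (show j + (b + 1) = n + 1 by omega)) :
    (totalLefschetz (complexBetti.map (fst Y Z) 2 η + complexBetti.map (snd Y Z) 2 η') ^ (a + b))
        (kunnethCross Y Z (ofDegree ℂ (ComplexPoints Y) i p ⊗ₜ ofDegree ℂ (ComplexPoints Z) j q)) =
      (((a + b).choose a : ℕ) : ℂ) • kunnethCross Y Z (ofDegree ℂ (ComplexPoints Y) (i + 2 * a) (lefschetzPow η a i p) ⊗ₜ
          ofDegree ℂ (ComplexPoints Z) (j + 2 * b) (lefschetzPow η' b j q)) := by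
  rw [pow_totalLefschetz_map_fst_add_map_snd_kunnethCross,
    pow_rTensor_add_lTensor_apply_tmul_primitive ((ofDegree_mem_primitiveSpace_iff hia η p).2 hp)
      ((ofDegree_mem_primitiveSpace_iff hjb η' q).2 hq),
    map_smul, pow_totalLefschetz_ofDegree, pow_totalLefschetz_ofDegree]

/-- **Lemme 1.3.1 (proof), homogeneous form: `L_θ^{a+b} (pr_Y^* p ⌣ pr_Z^* q) = C(a+b, a) · (pr_Y^* Lᵃ p ⌣ pr_Z^* L'ᵇ q)`
in `H^{i+j+2(a+b)}((Y × Z)(ℂ); ℂ)`** for `p ∈ Pⁱ(Y)` (`i + a = m`), `q ∈ Pʲ(Z)` (`j + b = n`).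
[cite: Andre1996Motifs, §1.3 Lemme 1.3.1 (p. 13, proof)] [cite: HatcherAT2002, §3.2 Thm. 3.16] -/
theorem lefschetzPow_cupProduct_map_fst_map_snd_top {η : complexBetti Y 2} {η' : complexBetti Z 2} {i a j b : ℕ}
    (hia : i + a = m) (hjb : j + b = n)
    {p : complexBetti Y i} (hp : p ∈ lefschetzPrimitive η (show i + (a + 1) = m + 1 by omega))
    {q : complexBetti Z j} (hq : q ∈ lefschetzPrimitive η' (show j + (b + 1) = n + 1 by omega)) :
    lefschetzPow (complexBetti.map (fst Y Z) 2 η + complexBetti.map (snd Y Z) 2 η') (a + b) (i + j)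
        (cupProduct rfl (complexBetti.map (fst Y Z) i p) (complexBetti.map (snd Y Z) j q)) =
      (((a + b).choose a : ℕ) : ℂ) •
        cupProduct (show (i + 2 * a) + (j + 2 * b) = i + j + 2 * (a + b) by ring)
          (complexBetti.map (fst Y Z) (i + 2 * a) (lefschetzPow η a i p))
          (complexBetti.map (snd Y Z) (j + 2 * b) (lefschetzPow η' b j q)) := by
  have h := pow_totalLefschetz_kunnethCross_tmul_ofDegree_top hia hjb hp hq
  rw [totalCross_tmul_ofDegree, totalCross_tmul_ofDegree, pow_totalLefschetz_ofDegree,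
    ofDegree_cupProduct_index rfl (show (i + 2 * a) + (j + 2 * b) = i + j + 2 * (a + b) by ring), ← map_smul] at h
  exact DirectSum.of_injective (β := fun k ↦ complexBetti (Y ⊗ Z) k) _ (by rw [← DirectSum.lof_eq_of ℂ]; exact h)

/-- **`x × y ≠ 0` in `H*((Y × Z)(ℂ); ℂ)` for non-zero homogeneous `x`, `y`** (`Y`, `Z` smooth projective: the Künneth
map is injective, and a pure tensor of non-zero vectors is non-zero). [cite: HatcherAT2002, §3.2 Thm. 3.16]
[cite: LooijengaLunts1997, §1 (1.1) p. 4 ("if both factors are nonzero")] -/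
theorem kunnethCross_tmul_ofDegree_ne_zero (hY : IsSmoothProjective m Y) (hZ : IsSmoothProjective n Z)
    {i j : ℕ} {x : complexBetti Y i} (hx : x ≠ 0) {y : complexBetti Z j}
    (hy : y ≠ 0) : kunnethCross Y Z (ofDegree ℂ (ComplexPoints Y) i x ⊗ₜ ofDegree ℂ (ComplexPoints Z) j y) ≠ 0 := by
  have hx' : ofDegree ℂ (ComplexPoints Y) i x ≠ 0 := fun h0 ↦
    hx (DirectSum.of_injective (β := fun k ↦ complexBetti Y k) _ (by rw [← DirectSum.lof_eq_of ℂ, map_zero]; exact h0))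
  have hy' : ofDegree ℂ (ComplexPoints Z) j y ≠ 0 := fun h0 ↦
    hy (DirectSum.of_injective (β := fun k ↦ complexBetti Z k) _ (by rw [← DirectSum.lof_eq_of ℂ, map_zero]; exact h0))
  intro h0
  exact tmul_ne_zero_of_ne_zero hx' hy' ((kunnethCross_bijective hY hZ).1 (by rw [h0, map_zero]))

/-- **The string through `p × q` has the exact length `a + b + 1`**: under hard Lefschetz of `η` (dimension `m`) and
`η'` (dimension `n`), for NON-ZERO primitive `p ∈ Pⁱ(Y)` (`i + a = m`), `q ∈ Pʲ(Z)` (`j + b = n`) the top class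
`L_θ^{a+b} (pr_Y^* p ⌣ pr_Z^* q) = C(a+b, a) · (pr_Y^* Lᵃ p ⌣ pr_Z^* L'ᵇ q)` is non-zero (`Lᵃ : Hⁱ(Y) → H^{2m-i}(Y)` and
`L'ᵇ` are injective, `C(a+b, a) ≠ 0`, and `pr_Y^* u ⌣ pr_Z^* v ≠ 0` for `u, v ≠ 0` — the tree's
`cupProduct_map_fst_map_snd_ne_zero_of_ne_zero`) — with `cupProduct_map_fst_map_snd_mem_lefschetzPrimitive`:
`p × q` generates the top Clebsch–Gordan summand `S^{a+b} ⊆ Sᵃ ⊗ Sᵇ`. [cite: Andre1996Motifs, §1.3 (p. 12, Clebsch–Gordan) and Lemme 1.3.1 (p. 13)]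
[cite: VoisinHodgeI2002, Thm. 6.25] -/
theorem lefschetzPow_cupProduct_map_fst_map_snd_top_ne_zero (hY : IsSmoothProjective m Y) (hZ : IsSmoothProjective n Z)
    {η : complexBetti Y 2} {η' : complexBetti Z 2} (hη : HasHardLefschetzProperty η m)
    (hη' : HasHardLefschetzProperty η' n) {i a j b : ℕ} (hia : i + a = m) (hjb : j + b = n)
    {p : complexBetti Y i} (hp : p ∈ lefschetzPrimitive η (show i + (a + 1) = m + 1 by omega)) (hp0 : p ≠ 0)
    {q : complexBetti Z j} (hq : q ∈ lefschetzPrimitive η' (show j + (b + 1) = n + 1 by omega)) (hq0 : q ≠ 0) :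
    lefschetzPow (complexBetti.map (fst Y Z) 2 η + complexBetti.map (snd Y Z) 2 η') (a + b) (i + j)
        (cupProduct rfl (complexBetti.map (fst Y Z) i p) (complexBetti.map (snd Y Z) j q)) ≠ 0 := by
  rw [lefschetzPow_cupProduct_map_fst_map_snd_top hia hjb hp hq]
  refine smul_ne_zero (Nat.cast_ne_zero.2 (Nat.choose_pos (Nat.le_add_right a b)).ne') ?_
  have h1 : lefschetzPow η a i p ≠ 0 := fun h0 ↦ hp0 ((hη a i hia).1 (by rw [h0, map_zero]))
  have h2 : lefschetzPow η' b j q ≠ 0 := fun h0 ↦ hq0 ((hη' b j hjb).1 (by rw [h0, map_zero]))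
  exact cupProduct_map_fst_map_snd_ne_zero_of_ne_zero hY hZ _ h1 h2

end Top

end Literature.AlgebraicGeometry.HodgeTheory

end
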